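import Summits.AtomisticToContinuum.HydrodynamicLimit.Theorems.MourreKoopmanChargesStressStrongMixingSpectralDensityConsequences
import HarnessLib

/-!
# `StressStrongMixing` · line `birth`, stub C1: the Green–Kubo route to Rajchman decay

Support file for the crux item stmt-AtomisticToContinuum-9584 (`StressStrongMixing`, route `MourreKoopmanCharges` of
`AtomisticToContinuum/HydrodynamicLimit`), line `birth` (lead c3).  The composition of the line needs only the DECAY
`c_F(s) = ⟪U_s ξ_Π, ξ_Π⟫_ℋ → 0` (`StressRajchman`); the registered open stub C1 `stub_stressSpectralDensity` reaches it
through an integrable spectral density and the Riemann–Lebesgue lemma.  This file records the ALTERNATIVE sufficient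
condition suggested by kinetic theory and molecular dynamics (`c(s) ≍ s^{-3/2}`, an integrable tail): decay follows from

* strong continuity of the Koopman orbit `s ↦ U_s ξ_Π` (already a CONSEQUENCE of C1, `stressSpectralDensity_consequences`),
  which makes `c_F` uniformly continuous (`uniformContinuous_inner_koopman_self`), and
* absolute integrability of the Green–Kubo integrand, `c_F ∈ L¹(ℝ)` (finiteness of the kinetic–kinetic shear viscosity
  as an absolutely convergent integral),

by the elementary real-variable lemma `tendsto_zero_of_uniformContinuous_of_integrable` (a uniformly continuous
integrable function on `ℝ` tends to `0` at `+∞`).  The assembled statement for the stress class is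
`tendsto_inner_koopman_self_of_integrable`.  Nothing here is specific to hard spheres: the lemmas are proved for the
Koopman group of an arbitrary `FluctuationDynamics`.

References: H. Spohn, *Large Scale Dynamics of Interacting Particles* (1991), Part I §7.1 and Part II §2.2 (Green–Kubo
formulae); W. Rudin, *Real and Complex Analysis*, Ch. 1 (tails of integrable functions).
-/

noncomputable section

open MeasureTheory ProbabilityTheory Filter Topology Set
open scoped InnerProductSpace ENNReal

namespace Summit.AtomisticToContinuum.HydrodynamicLimit.Theorems.MourreKoopmanChargesStressStrongMixing

open Literature.MathematicalPhysics.KineticTheory Literature.Analysis.FluidPDE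

/-! ### A uniformly continuous integrable function tends to zero -/

/-- **Tails of an integrable function vanish**: `∫_{(z, ∞)} |f| → 0` as `z → +∞`. [folklore] -/
theorem tendsto_setIntegral_Ioi_abs_atTop {f : ℝ → ℝ} (hi : Integrable f) :
    Tendsto (fun z : ℝ => ∫ y in Ioi z, |f y|) atTop (𝓝 0) := by
  have h := tendsto_setIntegral_of_antitone (μ := volume) (f := fun y => |f y|) (s := fun z : ℝ => Ioi z)
    (fun _ => measurableSet_Ioi) (fun _ _ hab => Ioi_subset_Ioi hab) ⟨0, hi.abs.integrableOn⟩
  have he : (⋂ n : ℝ, Ioi n) = ∅ :=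
    eq_empty_of_forall_notMem fun y hy => lt_irrefl y (mem_iInter.1 hy y)
  rw [he, Measure.restrict_empty, integral_zero_measure] at h
  exact h

/-- **A uniformly continuous integrable real function tends to `0` at `+∞`.**  For `0 < η` below the uniform-continuity
modulus of `ε/2`, `η |f(s)| ≤ ∫_{(s, s+η]} |f| + η ε/2 ≤ ∫_{(s, ∞)} |f| + η ε/2`, and the tail integral tends to `0`.
[folklore] -/
theorem tendsto_zero_of_uniformContinuous_of_integrable {f : ℝ → ℝ} (hu : UniformContinuous f) (hi : Integrable f) :
    Tendsto f atTop (𝓝 0) := by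
  rw [Metric.tendsto_atTop]
  intro ε hε
  obtain ⟨δ, hδ, hδf⟩ := Metric.uniformContinuous_iff.1 hu (ε / 2) (half_pos hε)
  set η : ℝ := δ / 2 with hη
  have hη0 : 0 < η := by positivity
  have hηδ : η < δ := by rw [hη]; linarith
  -- tails below `η ε / 2` from some point on
  have htail := tendsto_setIntegral_Ioi_abs_atTop hi
  rw [Metric.tendsto_atTop] at htail
  obtain ⟨N, hN⟩ := htail (η * (ε / 2)) (by positivity)
  refine ⟨N, fun s hs => ?_⟩
  have htail_s : ∫ y in Ioi s, |f y| < η * (ε / 2) := by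
    have h := hN s hs
    rw [Real.dist_eq, sub_zero, abs_of_nonneg (integral_nonneg fun _ => abs_nonneg _)] at h
    exact h
  -- the window estimate `η |f s| ≤ ∫_{(s, s+η]} |f| + η ε/2`
  have hvol : volume.real (Ioc s (s + η)) = η := by
    rw [measureReal_def, Real.volume_Ioc, add_sub_cancel_left, ENNReal.toReal_ofReal hη0.le]
  have hfin : volume (Ioc s (s + η)) ≠ ∞ := by rw [Real.volume_Ioc]; exact ENNReal.ofReal_ne_top
  have hconst : ∫ _ in Ioc s (s + η), |f s| = η * |f s| := by
    rw [setIntegral_const, hvol, smul_eq_mul]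
  have hconst' : ∫ _ in Ioc s (s + η), ε / 2 = η * (ε / 2) := by
    rw [setIntegral_const, hvol, smul_eq_mul]
  have hint_abs : IntegrableOn (fun t => |f t|) (Ioc s (s + η)) := hi.abs.integrableOn
  have hint_c : IntegrableOn (fun _ : ℝ => ε / 2) (Ioc s (s + η)) := integrableOn_const hfin
  have hwin : ∀ t ∈ Ioc s (s + η), |f s| ≤ |f t| + ε / 2 := by
    intro t ht
    have hdist : dist s t < δ := by
      rw [Real.dist_eq, abs_sub_comm, abs_of_nonneg (by linarith [ht.1])]
      linarith [ht.2]
    have h := hδf hdist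
    rw [Real.dist_eq] at h
    have : |f s| ≤ |f t| + |f s - f t| := by
      calc |f s| = |f t + (f s - f t)| := by ring_nf
        _ ≤ |f t| + |f s - f t| := abs_add_le _ _
    linarith
  have hle : η * |f s| ≤ (∫ t in Ioc s (s + η), |f t|) + η * (ε / 2) := by
    rw [← hconst, ← hconst', ← integral_add hint_abs hint_c]
    exact setIntegral_mono_on (integrableOn_const hfin) (hint_abs.add hint_c) measurableSet_Ioc hwin
  have hmono : (∫ t in Ioc s (s + η), |f t|) ≤ ∫ t in Ioi s, |f t| :=
    setIntegral_mono_set hi.abs.integrableOn (ae_of_all _ fun _ => abs_nonneg _)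
      (ae_of_all _ Ioc_subset_Ioi_self)
  have hkey : η * |f s| < η * ε := by
    calc η * |f s| ≤ (∫ t in Ioi s, |f t|) + η * (ε / 2) := hle.trans (by linarith)
      _ < η * (ε / 2) + η * (ε / 2) := by linarith
      _ = η * ε := by ring
  rw [Real.dist_eq, sub_zero]
  exact lt_of_mul_lt_mul_left hkey hη0.le

/-! ### The autocorrelation of a strongly continuous Koopman orbit is uniformly continuous -/

section Orbit

variable {G Ω : Type*} [AddCommGroup G] [MeasurableSpace G] [MeasurableSpace Ω] {ν : Measure G}
  {T : ShiftAction G Ω} [MeasurableNeg G] [ν.IsNegInvariant] (D : FluctuationDynamics ν T)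

/-- **Orbit increments depend only on the time difference**: `‖U_s ψ - U_t ψ‖ = ‖U_{s-t} ψ - ψ‖` for the orthogonal
Koopman group on the real Hilbert space `ℋ`. [folklore] -/
theorem norm_koopman_sub_koopman_eq (s t : ℝ) (ψ : D.FluctuationSpace) :
    ‖D.koopman s ψ - D.koopman t ψ‖ = ‖D.koopman (s - t) ψ - ψ‖ := by
  have h1 := norm_koopman_sub_koopman_sq D s t ψ
  have h2 := norm_koopman_sub_koopman_sq D (s - t) 0 ψ
  rw [sub_zero, D.koopman_zero_apply] at h2
  rw [D.koopman_zero_apply] at h1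
  have hsq : ‖D.koopman s ψ - D.koopman t ψ‖ ^ 2 = ‖D.koopman (s - t) ψ - ψ‖ ^ 2 := by rw [h1, h2]
  exact (sq_eq_sq₀ (norm_nonneg _) (norm_nonneg _)).1 hsq

/-- **A Koopman orbit that is continuous at time `0` is uniformly continuous** (`‖U_s ψ - U_t ψ‖ = ‖U_{s-t} ψ - ψ‖`).
[folklore] -/
theorem uniformContinuous_koopman_of_continuous {ψ : D.FluctuationSpace}
    (h : Continuous fun s : ℝ => D.koopman s ψ) : UniformContinuous fun s : ℝ => D.koopman s ψ := by
  rw [Metric.uniformContinuous_iff]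
  intro ε hε
  have h0 : Tendsto (fun u : ℝ => D.koopman u ψ) (𝓝 0) (𝓝 ψ) := by
    have := h.tendsto 0
    rwa [D.koopman_zero_apply] at this
  rcases Metric.tendsto_nhds_nhds.1 h0 ε hε with ⟨δ, hδ, H⟩
  refine ⟨δ, hδ, fun {s t} hst => ?_⟩
  rw [dist_eq_norm, norm_koopman_sub_koopman_eq D s t ψ, ← dist_eq_norm]
  apply H
  rwa [Real.dist_eq, sub_zero, ← Real.dist_eq]

/-- **The autocorrelation `s ↦ ⟪U_s ψ, ψ⟫` of a strongly continuous orbit is uniformly continuous** (composition of the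
uniformly continuous orbit with the uniformly continuous functional `⟪·, ψ⟫`). [folklore] -/
theorem uniformContinuous_inner_koopman_self {ψ : D.FluctuationSpace}
    (h : Continuous fun s : ℝ => D.koopman s ψ) : UniformContinuous fun s : ℝ => ⟪D.koopman s ψ, ψ⟫_ℝ := by
  have hlin : UniformContinuous fun φ : D.FluctuationSpace => ⟪ψ, φ⟫_ℝ := (innerSL ℝ ψ).uniformContinuous
  have e : (fun s : ℝ => ⟪D.koopman s ψ, ψ⟫_ℝ) = (fun φ : D.FluctuationSpace => ⟪ψ, φ⟫_ℝ) ∘ fun s : ℝ => D.koopman s ψ := by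
    funext s
    exact real_inner_comm _ _
  rw [e]
  exact hlin.comp (uniformContinuous_koopman_of_continuous D h)

/-- **Green–Kubo route to Rajchman decay, abstract form**: a strongly continuous Koopman orbit whose autocorrelation is
absolutely integrable on `ℝ` has autocorrelation tending to `0` at `+∞`. [folklore] -/
theorem tendsto_inner_koopman_self_of_continuous_of_integrable {ψ : D.FluctuationSpace}
    (h : Continuous fun s : ℝ => D.koopman s ψ) (hi : Integrable fun s : ℝ => ⟪D.koopman s ψ, ψ⟫_ℝ) :
    Tendsto (fun s : ℝ => ⟪D.koopman s ψ, ψ⟫_ℝ) atTop (𝓝 0) :=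
  tendsto_zero_of_uniformContinuous_of_integrable (uniformContinuous_inner_koopman_self D h) hi

end Orbit

/-! ### The stress class of the hard-sphere fluctuation data -/

/-- **Green–Kubo integrability plus strong continuity give strong mixing of the kinetic shear stress** (alternative
sufficient condition for the decay half `StressRajchman` of the line, recorded for the planners): for ANY hard-sphere
fluctuation data `F`, if the Koopman orbit of the stress class `ξ_Π = [Σ_{q ∈ [0,1)³} v⁰v¹]` is strongly continuous and its
autocorrelation `c_F(s) = ⟪U_s ξ_Π, ξ_Π⟫_ℋ` (the Green–Kubo integrand of the kinetic–kinetic shear viscosity) is absolutely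
integrable on `ℝ`, then `c_F(s) → 0` as `s → ∞`.  (Under C1 the continuity hypothesis is automatic,
`stressSpectralDensity_consequences`; molecular dynamics: `c(s) ≍ s^{-3/2}`, integrable.) [folklore] -/
theorem tendsto_inner_koopman_self_of_integrable :
    ∀ (σ : ℝ) (F : HardSphereFluctuationData σ),
      (Continuous fun s : ℝ => F.koopman s (F.fluct (cellObs fun v : V3 => v 0 * v 1))) →
      Integrable (fun s : ℝ => ⟪F.koopman s (F.fluct (cellObs fun v : V3 => v 0 * v 1)),
          F.fluct (cellObs fun v : V3 => v 0 * v 1)⟫_ℝ) →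
      Tendsto (fun s : ℝ => ⟪F.koopman s (F.fluct (cellObs fun v : V3 => v 0 * v 1)),
          F.fluct (cellObs fun v : V3 => v 0 * v 1)⟫_ℝ) atTop (𝓝 0) := by
  intro σ F hcont hint
  exact tendsto_inner_koopman_self_of_continuous_of_integrable F.toFluctuationDynamics hcont hint

end Summit.AtomisticToContinuum.HydrodynamicLimit.Theorems.MourreKoopmanChargesStressStrongMixing

end
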